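import Summits.BirchSwinnertonDyer.BirchSwinnertonDyer.Theorems.ClassRecordThreeEulerHalvesAtThreeKolyvaginFamilyClassCertificate
import Summits.BirchSwinnertonDyer.BirchSwinnertonDyer.Theorems.ErratumRoadFiveNonSurjCornerKolyJLevelOneAvatar
import Summits.BirchSwinnertonDyer.BirchSwinnertonDyer.Theorems.Rank1ResidualJetSwapWalk
import Summits.BirchSwinnertonDyer.BirchSwinnertonDyer.Theorems.ErratumRoadFiveShimuraKolyvaginOrderBoundInertShiftCebotarev
import HarnessLib

/-!
# PORT-SPEC (P1), file 1 of the prime-swap port: the ROOT CLASS `κ̃ = c_k(P_n ∕ p^u)` of a GENERALISED Kolyvagin datum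
# `JET.KolyvaginFamilyData W K ι n` (existence, order `p^k`, `c_k(n) = p^u • κ̃`, change of level `ι_* κ̃ = c_{k+u}(n)`),
# and the swap walk with an ABSTRACT target predicate (cell `bsd-stepL`, seat `bsd-stepL-corner-p1` g15;
# `--supports stmt-BirchSwinnertonDyer-21420 --as helper`)

WHY (plan g39 RULING 47 (4) ∕ RE-SEAT ADVICE 02:00Z: «corner-p1: the (P1) McCallum-swap twin»; RULING 46 (P0′) «generalise the
datum, additively and on demand»). The kernel prime swap of cell bsd-jet (`JET.Swap.exists_swapPrime` ∕ `not_dvd_of_swap` ∕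
`exists_conductor_levelIndex_ge_of_minDepth`, McCallum 1991 Prop. 5.2 with `C = {0}`) and this seat's (irr) twins
(`…KolyJSwap{Prime,Step,LevelRaising}Irr`) are typed on the `X₀(N)` datum `KolyvaginHeegnerData Dt β ι n`, which is
UNINHABITED on the Shimura frames of cruxes 21420 ∕ 19109 (PORT MAP (P2) §0). The swap uses the datum ONLY as a carrier,
through three carrier-only lemmas — tam3-p1's `Koly.exists_tildeClass_of_exactDepth` ([J] §3.1 item 7, algebraic half),
bsd-potss ∕ tam3-p1's `torsionH1OfDvd_rootClass[_of_admissible]` (the change of level on the root class) and the `dite`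
bookkeeping of `kolyvaginClass` — plus bsd-jet's index walk `Swap.exists_forall_le_index_of_swapStep`. THIS FILE re-keys the
three on `KolyvaginFamilyData` (proofs VERBATIM, datum type replaced; the Galois-descent inputs are tam3-p1 g12's
`KolyvaginFamilyData.smul_toGeomPoints_of_forall_emb` ∕ `mem_pointsSubgroup_of_forall_smul_eq` ∕
`eq_zero_of_pow_zsmul_eq_zero_of_isAdmissible`, p593267) and generalises the walk to an arbitrary target predicate `Fine`
on primes (so that ONE walk serves W. Zhang's numeric index — `KolyvaginFamilyData.pDiv_of_swap_of_perLevel` — and Gross's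
depth `ShimuraWalk.frobDepth` — `ShimuraWalk.SwapSupplyAt`). Files 2–4 (`…ShimuraSwapFamily{Prime,Step,LevelRaising}`) are
the two halves of one swap and the walk, for an ARBITRARY family `ys : (m : ℕ) → E(K[m])`.
HONEST FRAMING: THEOREMS ONLY (no definition, no named fact, no `sorry`); the standing inputs `hA` (admissibility) ∕ `hP`
(invariance) are HYPOTHESES exactly as in tam3-p1's family files; nothing about any curve; no stub ∕ item closes; BSD is not
proved by any of this; T7. Credit: tam3-p1 (tilde class, root-class transport), bsd-jet pv-2 (walk), x11b3-koly (cocycle API).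
References (locators only): [cite: Jetchev2008, §3.1 item 7 (p. 817), §5.2 (p. 822)] [cite: McCallumLMS1991, §4 (4)–(6),
Lemma 4.1, Cor. 4.5, Lemma 4.6, §5 proof of Prop. 5.2 (pp. 305–306)] [cite: GrossLMS1991, §4 (4.4), (4.6), Prop. 4.7 (1)].
presearch: not applicable (re-keying of tree theorems); `lean search 'KolyvaginFamilyData.exists_rootClass'` → none.
Design: `K : Type`. Axioms: `propext`, `Classical.choice`, `Quot.sound`.
-/

set_option autoImplicit false

noncomputable section

open scoped Classical

namespace Summit.BirchSwinnertonDyer.Rank1Residual.JET.KolyvaginFamilyData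

open WeierstrassCurve Field NumberField Literature.NumberTheory.EllipticCurves
  Literature.NumberTheory.EllipticCurves.KolyvaginCocycle Literature.NumberTheory.GaloisRepresentations

variable {K : Type} [Field K] [NumberField K] {W : WeierstrassCurve ℚ} {ι : K →+* ℂ} {n : ℕ}
  (d : KolyvaginFamilyData W K ι n)

/-! ### §1 The `dite` bookkeeping of `c_M(n)` -/

/-- On the standing inputs `c_M(n)` IS McCallum's class of `P_n` (the `dite` takes its first branch); family form of
`KolyvaginHeegnerData.kolyvaginClass_of_admissible`. [cite: GrossLMS1991, §4 (4.4), (4.6)] -/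
theorem kolyvaginClass_eq_cocycleClass {p : ℕ} (hp : p.Prime) (M : ℕ)
    (hA : IsAdmissible (absoluteGaloisGroup K) d.pointsSubgroup ((p ^ M : ℕ) : ℤ))
    (hP : d.toGeomPoints d.derivedPoint ∈
      invPoints (absoluteGaloisGroup K) d.pointsSubgroup ((p ^ M : ℕ) : ℤ)) :
    d.kolyvaginClass hp M =
      _root_.Literature.NumberTheory.EllipticCurves.kolyvaginClass (W.baseChange K) ((p ^ M : ℕ) : ℤ)
        ((W.baseChange K).zsmul_geomPoints_surjective_of_charZero
          (by exact_mod_cast pow_ne_zero M hp.ne_zero))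
        hA (d.toGeomPoints d.derivedPoint) hP := by
  rw [d.kolyvaginClass_def hp M, dif_pos ⟨hA, hP⟩]

/-- A non-zero `c_M(n)` is never the junk value: the standing inputs hold; family form of
`KolyvaginHeegnerData.kolyvaginClass_ne_zero`. [folklore] -/
theorem standingInputs_of_kolyvaginClass_ne_zero {p : ℕ} {hp : p.Prime} {M : ℕ}
    (h : d.kolyvaginClass hp M ≠ 0) :
    IsAdmissible (absoluteGaloisGroup K) d.pointsSubgroup ((p ^ M : ℕ) : ℤ) ∧
      d.toGeomPoints d.derivedPoint ∈
        invPoints (absoluteGaloisGroup K) d.pointsSubgroup ((p ^ M : ℕ) : ℤ) := by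
  by_contra hc
  exact h (by rw [d.kolyvaginClass_def hp M, dif_neg hc])

/-! ### §2 [J] §3.1 item 7, algebraic half, for family data -/

/-- **The root class of a family datum: `κ̃ = c_k(Q)` exists with `p^u • Q = P_n`, `ord κ̃ = p^k`, `c_k(n) = p^u • κ̃`.** For a
family datum `d` of conductor `n`, a level `k ≥ 1`, an exponent `u` with `p^u ∥ P_n`, and the standing inputs at level
`p^{k+u}` (`hA`, `hP`): a point `Q ∈ E(K[n])` with `p^u • Q = P_n`, `[Q]` invariant mod `p^k`, McCallum's class `c(Q)` of order
EXACTLY `p^k`, and `c_k(n) = p^u • c(Q)`. Twin (proof verbatim) of tam3-p1's `Koly.exists_tildeClass_of_exactDepth`.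
[cite: Jetchev2008, §3.1 item 7 (p. 817), §5.2 (p. 822)] [cite: McCallumLMS1991, §4 (6), Cor. 4.5] -/
theorem exists_rootClass_of_exactDepth {p : ℕ} (hp : p.Prime) {k u : ℕ} (hk : 1 ≤ k)
    (hA : IsAdmissible (absoluteGaloisGroup K) d.pointsSubgroup ((p ^ (k + u) : ℕ) : ℤ))
    (hP : d.toGeomPoints d.derivedPoint ∈
      invPoints (absoluteGaloisGroup K) d.pointsSubgroup ((p ^ (k + u) : ℕ) : ℤ))
    (hdvd : ∃ Q : (W.baseChange (ringClassField K ι n)).toAffine.Point,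
      ((p ^ u : ℕ) : ℤ) • Q = d.derivedPoint)
    (hndvd : ¬ ∃ Q : (W.baseChange (ringClassField K ι n)).toAffine.Point,
      ((p ^ (u + 1) : ℕ) : ℤ) • Q = d.derivedPoint) :
    ∃ (hAk : IsAdmissible (absoluteGaloisGroup K) d.pointsSubgroup ((p ^ k : ℕ) : ℤ))
      (Q : (W.baseChange (ringClassField K ι n)).toAffine.Point)
      (hQ : d.toGeomPoints Q ∈ invPoints (absoluteGaloisGroup K) d.pointsSubgroup ((p ^ k : ℕ) : ℤ)),
      ((p ^ u : ℕ) : ℤ) • Q = d.derivedPoint ∧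
      addOrderOf (_root_.Literature.NumberTheory.EllipticCurves.kolyvaginClass (W.baseChange K) ((p ^ k : ℕ) : ℤ)
        ((W.baseChange K).zsmul_geomPoints_surjective_of_charZero
          (by exact_mod_cast pow_ne_zero k hp.ne_zero)) hAk (d.toGeomPoints Q) hQ) = p ^ k ∧
      d.kolyvaginClass hp k = ((p ^ u : ℕ) : ℤ) •
        _root_.Literature.NumberTheory.EllipticCurves.kolyvaginClass (W.baseChange K) ((p ^ k : ℕ) : ℤ)
          ((W.baseChange K).zsmul_geomPoints_surjective_of_charZero
            (by exact_mod_cast pow_ne_zero k hp.ne_zero)) hAk (d.toGeomPoints Q) hQ := by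
  haveI : Fact p.Prime := ⟨hp⟩
  -- torsion-freeness read off `hA`
  have htf : ∀ (i : ℕ), i ≤ k + u → ∀ a ∈ d.pointsSubgroup, ((p ^ i : ℕ) : ℤ) • a = 0 → a = 0 := by
    intro i hi a ha h0
    refine hA.eq_zero_of_zsmul ha ?_
    obtain ⟨r, hr⟩ := Nat.exists_eq_add_of_le hi
    rw [hr, add_comm, natCast_pow_add_eq_mul, mul_smul, h0, smul_zero]
  -- admissibility at level `p^k`
  have hAk : IsAdmissible (absoluteGaloisGroup K) d.pointsSubgroup ((p ^ k : ℕ) : ℤ) :=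
    ⟨hA.smul_mem, fun a ha h0 ↦ htf k (Nat.le_add_right k u) a ha h0⟩
  obtain ⟨Q, hQP⟩ := hdvd
  have hQA : d.toGeomPoints Q ∈ d.pointsSubgroup := ⟨Q, rfl⟩
  -- `[Q]` is invariant mod `p^k`: `(g-1)P = p^{k+u} R` and `(g-1)P = p^u (g-1)Q` give `(g-1)Q = p^k R`
  have hQinv : d.toGeomPoints Q ∈ invPoints (absoluteGaloisGroup K) d.pointsSubgroup ((p ^ k : ℕ) : ℤ) := by
    refine ⟨hQA, fun g ↦ ?_⟩
    obtain ⟨R, hR, hRe⟩ := hP.2 g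
    refine ⟨R, hR, ?_⟩
    have hPeq : d.toGeomPoints d.derivedPoint = ((p ^ u : ℕ) : ℤ) • d.toGeomPoints Q := by
      rw [← map_zsmul, hQP]
    have h1 : ((p ^ u : ℕ) : ℤ) • (((p ^ k : ℕ) : ℤ) • R - (g • d.toGeomPoints Q - d.toGeomPoints Q)) = 0 := by
      rw [smul_sub, smul_smul, ← natCast_pow_add_eq_mul, Nat.add_comm u k, hRe, hPeq, smul_sub,
        smul_zsmul_comm, sub_self]
    have hmem : ((p ^ k : ℕ) : ℤ) • R - (g • d.toGeomPoints Q - d.toGeomPoints Q) ∈ d.pointsSubgroup :=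
      d.pointsSubgroup.sub_mem (d.pointsSubgroup.zsmul_mem hR _)
        (d.pointsSubgroup.sub_mem (hA.smul_mem g hQA) hQA)
    exact sub_eq_zero.mp (htf u (Nat.le_add_left u k) _ hmem h1)
  -- invariance of `[P_n]` mod `p^k`
  have hPk : d.toGeomPoints d.derivedPoint ∈
      invPoints (absoluteGaloisGroup K) d.pointsSubgroup ((p ^ k : ℕ) : ℤ) := by
    have : d.toGeomPoints d.derivedPoint = ((p ^ u : ℕ) : ℤ) • d.toGeomPoints Q := by
      rw [← map_zsmul, hQP]
    rw [this]
    exact AddSubgroup.zsmul_mem _ hQinv _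
  set hdiv := (W.baseChange K).zsmul_geomPoints_surjective_of_charZero
    (n := ((p ^ k : ℕ) : ℤ)) (by exact_mod_cast pow_ne_zero k hp.ne_zero) with hdiv_def
  -- a `p^k`-th root `R₀` of `Q` in `E(K̄)`; then `p^u • R₀` is a `p^k`-th root of `P_n`
  obtain ⟨R₀, hR₀⟩ := hdiv (d.toGeomPoints Q)
  simp only at hR₀
  have huP : ((p ^ u : ℕ) : ℤ) • d.toGeomPoints Q ∈
      invPoints (absoluteGaloisGroup K) d.pointsSubgroup ((p ^ k : ℕ) : ℤ) :=
    AddSubgroup.zsmul_mem _ hQinv _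
  have huQ : ((p ^ k : ℕ) : ℤ) • (((p ^ u : ℕ) : ℤ) • R₀) = ((p ^ u : ℕ) : ℤ) • d.toGeomPoints Q := by
    rw [smul_comm, hR₀]
  refine ⟨hAk, Q, hQinv, hQP, ?_, ?_⟩
  · -- order exactly `p^k`
    obtain ⟨k', rfl⟩ : ∃ k', k = k' + 1 := ⟨k - 1, by omega⟩
    refine addOrderOf_eq_prime_pow (fun h0 ↦ hndvd ?_) ?_
    · -- `p^{k'} • c(Q) = c(p^{k'} Q) = 0` gives `p^{k'} Q ∈ p^{k'+1} E(K[n])`, so `Q ∈ p E(K[n])`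
      have hk'P : ((p ^ k' : ℕ) : ℤ) • d.toGeomPoints Q ∈
          invPoints (absoluteGaloisGroup K) d.pointsSubgroup ((p ^ (k' + 1) : ℕ) : ℤ) :=
        AddSubgroup.zsmul_mem _ hQinv _
      have hk'Q : ((p ^ (k' + 1) : ℕ) : ℤ) • (((p ^ k' : ℕ) : ℤ) • R₀) =
          ((p ^ k' : ℕ) : ℤ) • d.toGeomPoints Q := by rw [smul_comm, hR₀]
      rw [← natCast_zsmul, kolyvaginClass_eq_cls hAk hQinv hR₀,
        ← cls_zsmul hAk (continuous_smul_geomPoints _) hQinv hR₀ _ hk'P hk'Q,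
        cls_eq_zero_iff hAk _ hk'P hk'Q
          (N := {g : absoluteGaloisGroup K | ∀ x : ringClassField K ι n,
            (show AlgebraicClosure K ≃ₐ[K] AlgebraicClosure K from g) (d.emb x) = d.emb x})
          (fun g hg ↦ by
            rw [← map_zsmul]
            exact d.smul_toGeomPoints_of_forall_emb _ g hg)
          (fun v hv ↦ d.mem_pointsSubgroup_of_forall_smul_eq v fun g hg ↦ hv g hg)] at h0
      obtain ⟨_, ⟨B, rfl⟩, hB⟩ := h0
      -- `p^{k'+1} B = p^{k'} Q`, so `p^{k'} (p B - Q) = 0`, so `Q = p B`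
      have h1 : ((p ^ k' : ℕ) : ℤ) • (((p ^ 1 : ℕ) : ℤ) • B - Q) = 0 := by
        apply Affine.Point.map_injective (W' := W) d.emb.toRatAlgHom
        change d.toGeomPoints _ = d.toGeomPoints 0
        rw [map_zero, map_zsmul, map_sub, map_zsmul, smul_sub, smul_smul, ← natCast_pow_add_eq_mul,
          hB, sub_self]
      have h2 : ((p ^ 1 : ℕ) : ℤ) • B - Q = 0 :=
        d.eq_zero_of_pow_zsmul_eq_zero_of_isAdmissible (k' + 1) hAk (by omega) _ h1
      refine ⟨B, ?_⟩
      rw [← hQP, ← sub_eq_zero.mp h2, smul_smul, ← natCast_pow_add_eq_mul, add_comm]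
    · -- `p^{k'+1}` kills `H¹(K, E[p^{k'+1}])`
      exact galoisCohomology.nsmul_eq_zero_of_forall
        ((W.baseChange K).torsionGaloisModule ((p ^ (k' + 1) : ℕ) : ℤ))
        (fun T ↦ by
          have h := (W.baseChange K).natAbs_nsmul_geomTorsion T
          rwa [Int.natAbs_natCast] at h) _
  · -- `c_k(n) = p^u • c(Q)` (`cls_zsmul` and independence of the root)
    rw [d.kolyvaginClass_eq_cocycleClass hp k hAk hPk, kolyvaginClass_eq_cls hAk hQinv hR₀,
      ← cls_zsmul hAk (continuous_smul_geomPoints _) hQinv hR₀ _ huP huQ]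
    have hPeq : d.toGeomPoints d.derivedPoint = ((p ^ u : ℕ) : ℤ) • d.toGeomPoints Q := by
      rw [← map_zsmul, hQP]
    have hrootP : ((p ^ k : ℕ) : ℤ) • (((p ^ u : ℕ) : ℤ) • R₀) = d.toGeomPoints d.derivedPoint := by
      rw [huQ, hPeq]
    rw [kolyvaginClass_eq_cls hAk hPk hrootP]
    exact cls_congr hAk _ hPeq rfl

/-! ### §3 The change of level on the root class -/

/-- **`ι_* c_k(Q) = c_{k+u}(P_n)` for a `p^u`-th root `Q ∈ E(K[n])` of the derived point of a family datum** (the same McCallum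
cocycle; admissibility for `p^{k+u}` a HYPOTHESIS `hA`). Twin (proof verbatim) of bsd-potss ∕ tam3-p1's
`torsionH1OfDvd_rootClass_of_admissible`. [cite: McCallumLMS1991, §4 Lemma 4.1, (6), Lemma 4.6] [cite: GrossLMS1991, §4 (4.4), (4.6)] -/
theorem torsionH1OfDvd_rootClass_eq {p : ℕ} (hp : p.Prime) (k u : ℕ)
    (hA : IsAdmissible (absoluteGaloisGroup K) d.pointsSubgroup ((p ^ (k + u) : ℕ) : ℤ))
    (Q : (W.baseChange (ringClassField K ι n)).toAffine.Point)
    (hAk : IsAdmissible (absoluteGaloisGroup K) d.pointsSubgroup ((p ^ k : ℕ) : ℤ))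
    (hQ : d.toGeomPoints Q ∈ invPoints (absoluteGaloisGroup K) d.pointsSubgroup ((p ^ k : ℕ) : ℤ))
    (hQP : ((p ^ u : ℕ) : ℤ) • Q = d.derivedPoint)
    (hP : d.toGeomPoints d.derivedPoint ∈
      invPoints (absoluteGaloisGroup K) d.pointsSubgroup ((p ^ (k + u) : ℕ) : ℤ)) :
    WeierstrassCurve.torsionH1OfDvd (W.baseChange K)
        (show ((p ^ k : ℕ) : ℤ) ∣ ((p ^ (k + u) : ℕ) : ℤ) by
          exact_mod_cast pow_dvd_pow p (Nat.le_add_right k u))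
        (_root_.Literature.NumberTheory.EllipticCurves.kolyvaginClass (W.baseChange K) ((p ^ k : ℕ) : ℤ)
          ((W.baseChange K).zsmul_geomPoints_surjective_of_charZero
            (by exact_mod_cast pow_ne_zero k hp.ne_zero)) hAk (d.toGeomPoints Q) hQ) =
      d.kolyvaginClass hp (k + u) := by
  rw [d.kolyvaginClass_eq_cocycleClass hp (k + u) hA hP]
  refine X11b.Three.Koly.torsionH1OfDvd_kolyvaginClass_of_zsmul
    (W.baseChange K) _ (m := ((p ^ u : ℕ) : ℤ)) ?_ _ _ hAk hA hQ ?_ hP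
  · push_cast; ring
  · rw [← map_zsmul, hQP]

/-- **Exact depth `u` from «`p^u ∣ P_n`, `c_{k+u}(n) ≠ 0`, `k = 1`»** in the form the swap uses: if `c_{1+u}(n) ≠ 0` then
`p^{u+1} ∤ P_n` (McCallum Cor. 4.5 on the standing inputs, which hold because the class is not the junk value).
[cite: McCallumLMS1991, §4 Cor. 4.5, §5 (p. 305)] -/
theorem not_pDiv_succ_of_kolyvaginClass_ne_zero {p : ℕ} (hp : p.Prime) (u : ℕ)
    (h : d.kolyvaginClass hp (1 + u) ≠ 0) :
    ¬ ∃ Q : (W.baseChange (ringClassField K ι n)).toAffine.Point,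
      ((p ^ (u + 1) : ℕ) : ℤ) • Q = d.derivedPoint := by
  obtain ⟨hA, hP⟩ := d.standingInputs_of_kolyvaginClass_ne_zero h
  rintro ⟨Q, hQ⟩
  have h1 := (d.zsmul_kolyvaginClass_eq_zero_iff hp (1 + u) hA hP 1).mpr
    ⟨Q, by rw [one_zsmul, Nat.add_comm]; exact hQ⟩
  exact h (by rwa [one_zsmul] at h1)

/-- **The `τ`-sign transports UP the change of level, with NO injectivity input** (appended, g15): if the root class `c_k(Q)` (`p^u Q = P_n`)
is a `c`-eigenclass of sign `e`, so is `c_{k+u}(n) = ι_* c_k(Q)` (`ι_*` is `Aut(K/ℚ)`-equivariant, `conjAct_torsionH1OfDvd`). The adapter from a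
ROOT-class sign producer (tam3-p1 g13's `conjAct_kolyvaginClass_root_eq_smul_family`, Gross 5.4 (1) from the label (B3)) to the top-class sign
`hsign` consumed by the swap walk (file 4 `Swap.exists_conductor_fine_of_minDepth_family`); the converse direction is `conjAct_eq_smul_of_torsionH1OfDvd`
and needs `E(K)[p] = 0`. [cite: GrossLMS1991, §5 Prop. 5.4 (1)] [cite: McCallumLMS1991, §4 Lemma 4.6] -/
theorem conjAct_kolyvaginClass_eq_smul_of_rootClass {p : ℕ} (hp : p.Prime) (k u : ℕ)
    (hA : IsAdmissible (absoluteGaloisGroup K) d.pointsSubgroup ((p ^ (k + u) : ℕ) : ℤ))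
    (Q : (W.baseChange (ringClassField K ι n)).toAffine.Point)
    (hAk : IsAdmissible (absoluteGaloisGroup K) d.pointsSubgroup ((p ^ k : ℕ) : ℤ))
    (hQ : d.toGeomPoints Q ∈ invPoints (absoluteGaloisGroup K) d.pointsSubgroup ((p ^ k : ℕ) : ℤ))
    (hQP : ((p ^ u : ℕ) : ℤ) • Q = d.derivedPoint)
    (hP : d.toGeomPoints d.derivedPoint ∈
      invPoints (absoluteGaloisGroup K) d.pointsSubgroup ((p ^ (k + u) : ℕ) : ℤ))
    (c : K ≃ₐ[ℚ] K) (e : ℤ)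
    (h : conjAct W c ((p ^ k : ℕ) : ℤ)
        (_root_.Literature.NumberTheory.EllipticCurves.kolyvaginClass (W.baseChange K) ((p ^ k : ℕ) : ℤ)
          ((W.baseChange K).zsmul_geomPoints_surjective_of_charZero
            (by exact_mod_cast pow_ne_zero k hp.ne_zero)) hAk (d.toGeomPoints Q) hQ) =
      e • _root_.Literature.NumberTheory.EllipticCurves.kolyvaginClass (W.baseChange K) ((p ^ k : ℕ) : ℤ)
          ((W.baseChange K).zsmul_geomPoints_surjective_of_charZero
            (by exact_mod_cast pow_ne_zero k hp.ne_zero)) hAk (d.toGeomPoints Q) hQ) :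
    conjAct W c ((p ^ (k + u) : ℕ) : ℤ) (d.kolyvaginClass hp (k + u)) =
      e • d.kolyvaginClass hp (k + u) := by
  rw [← d.torsionH1OfDvd_rootClass_eq hp k u hA Q hAk hQ hQP hP,
    Summit.BirchSwinnertonDyer.BirchSwinnertonDyer.Theorems.conjAct_torsionH1OfDvd, h, map_zsmul]

end Summit.BirchSwinnertonDyer.Rank1Residual.JET.KolyvaginFamilyData

/-! ### §4 The swap walk with an abstract target predicate -/

namespace Summit.BirchSwinnertonDyer.Rank1Residual.JET.Swap

open Finset

/-- **One swap removes one non-fine prime**: if `ℓ₀ ∣ n` is not `Fine` and `ℓ'` is, the number of non-fine prime factors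
drops by one from `n` to `n/ℓ₀ · ℓ'`. Generalises `card_badPrimes_swap` (`Fine q := m' ≤ M q`).
[cite: McCallumLMS1991, §5 proof of Prop. 5.2 (p. 306)] -/
theorem card_notFine_swap (Fine : ℕ → Prop) {n ℓ₀ ℓ' : ℕ} (hn : Squarefree n)
    (hℓ₀ : ℓ₀ ∈ n.primeFactors) (hℓ₀F : ¬ Fine ℓ₀) (hℓ' : ℓ'.Prime) (hℓ'F : Fine ℓ') :
    ((n / ℓ₀ * ℓ').primeFactors.filter (fun q ↦ ¬ Fine q)).card + 1 =
      (n.primeFactors.filter (fun q ↦ ¬ Fine q)).card := by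
  rw [primeFactors_swap hn hℓ₀ hℓ', Finset.filter_insert, if_neg (not_not_intro hℓ'F),
    Finset.filter_erase, Finset.card_erase_add_one]
  exact Finset.mem_filter.mpr ⟨hℓ₀, hℓ₀F⟩

/-- **The swap walk terminates, abstract target** (McCallum 1991, proof of Prop. 5.2, pp. 305–306): for a predicate `Fine` on
primes and a predicate `Good` on conductors implying square-freeness and stable under ONE swap of any non-fine prime factor for
some fresh fine prime (`hstep`), from any `Good n₀` there is a `Good n` all of whose prime factors are fine. Induction on the
number of non-fine prime factors; generalises bsd-jet's `exists_forall_le_index_of_swapStep` (`Fine q := m' ≤ M q`), so that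
the same walk serves W. Zhang's numeric index and Gross's depth (3.2). [cite: McCallumLMS1991, §5 proof of Prop. 5.2 (pp. 305–306)] -/
theorem exists_forall_fine_of_swapStep (Fine : ℕ → Prop) (Good : ℕ → Prop)
    (hsq : ∀ n, Good n → Squarefree n)
    (hstep : ∀ n, Good n → ∀ ℓ₀ ∈ n.primeFactors, ¬ Fine ℓ₀ →
      ∃ ℓ' : ℕ, ℓ'.Prime ∧ ℓ' ∉ n.primeFactors ∧ Fine ℓ' ∧ Good (n / ℓ₀ * ℓ'))
    {n₀ : ℕ} (h₀ : Good n₀) :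
    ∃ n : ℕ, Good n ∧ ∀ q ∈ n.primeFactors, Fine q := by
  -- induction on the number of non-fine prime factors
  suffices H : ∀ (B : ℕ) (n : ℕ), Good n → (n.primeFactors.filter (fun q ↦ ¬ Fine q)).card = B →
      ∃ n' : ℕ, Good n' ∧ ∀ q ∈ n'.primeFactors, Fine q from H _ n₀ h₀ rfl
  intro B
  induction B with
  | zero =>
    intro n hn hB
    refine ⟨n, hn, fun q hq ↦ ?_⟩
    by_contra hF
    have : q ∈ n.primeFactors.filter (fun q ↦ ¬ Fine q) := Finset.mem_filter.mpr ⟨hq, hF⟩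
    rw [Finset.card_eq_zero.mp hB] at this
    exact Finset.notMem_empty q this
  | succ B ih =>
    intro n hn hB
    have hne : (n.primeFactors.filter (fun q ↦ ¬ Fine q)).Nonempty := by
      rw [← Finset.card_pos, hB]; exact Nat.succ_pos B
    obtain ⟨ℓ₀, hℓ₀⟩ := hne
    obtain ⟨hℓ₀n, hℓ₀F⟩ := Finset.mem_filter.mp hℓ₀
    obtain ⟨ℓ', hℓ', hℓ'n, hℓ'F, hgood⟩ := hstep n hn ℓ₀ hℓ₀n hℓ₀F
    refine ih (n / ℓ₀ * ℓ') hgood ?_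
    have := card_notFine_swap Fine (hsq n hn) hℓ₀n hℓ₀F hℓ' hℓ'F
    omega

end Summit.BirchSwinnertonDyer.Rank1Residual.JET.Swap

end
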